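import Literature.NumberTheory.Automorphic.UnitaryThreeAnisotropicStabilizerCosetInvariant    -- ★ FILE 2d (this seat): `mk_eq_mk_iff_invariant`, realisation on fibres
import Literature.NumberTheory.Automorphic.UnitaryThreeAnisotropicStabilizerResidueData       -- ★ FILE 2e-α (this seat)
import Literature.NumberTheory.Automorphic.UnitaryThreePHTowerIndex                         -- ★ `toQuotPow` API (A-p03∕B-p04 (F3c-β-ii))
import Literature.NumberTheory.LocalFields.UnramifiedQuadraticNormFibreProductCount           -- ★ B-p10 p841656: `(q+1)q^(4m)`
import HarnessLib

/-!
# `[Stab(w₀) : H′_m] = (q + 1)·q^{4m}`: the coset space of the anisotropic stabiliser is the product of the `q∕s`-residues mod `𝔭^m` and the norm-one residues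
# mod `𝔭^{2m+1}` (Flicker 1998, Prop. 16 p. 96 — LAYER B′ step 2, FILE 2e-β)

Topic `NumberTheory/Automorphic`; namespace `Literature.NumberTheory.Automorphic.UnitaryGroup`.  THEOREMS ONLY (no `def`, no instance, no notation, no named fact, no
`sorry`; count-neutral).  Cell `pub/hodgecm-mathlib`, F0∕P3a road «D-N7-inert», line «N7nsCount» ((F11-c) `stub_irredGValueNeg`); LAYER B′ design pen + cutting hand
A-p13 (g30) (LEAD F0P3a-plan (g9) T8-92 ff.; DESIGN v3 `F0/P3a/A-p13/g30/DESIGN-LayerBprime-v3.A-p13g30.md`).  HONEST LABEL: HC_CM is proved only modulo the printed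
citations until rung 0 closes.

THE MATHEMATICS.  `S = Stab(w₀)`, `H′_m = S ∩ d_m K₀ d_m⁻¹` (★ (F2′) tokens).  The map `ρ : S → (𝒪⧸𝔭^m) × {x̄ ∈ 𝒪⧸𝔭^{2m+1} : x̄·σ̄x̄ = 1}`,
`ρ(z) = (q∕s mod 𝔭^m, ι(z) mod 𝔭^{2m+1})`, `ι(z) = D_z·Φ(v_z, v₀)` with `v₀ = (s₀, u₀s₀)` the canonical `σ`-fixed unit vector over the chosen representative `u₀` of the
class of `q∕s` (★ 2e-α `exists_fixed_unit_vector`), is constant on `H′_m`-cosets and separates them (★ 2d `mk_eq_mk_iff_invariant`; `ι` has norm `≡ 1` by ★ 2e-α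
`v_norm_invariant_sub_one_le`), and is ONTO: the class `(ū, x̄)` is hit by the stabiliser element with coordinates `(A, q, s) = (θ·s₀, u₀s₀, s₀)`, `θ ∈ E¹`, `θ ≡ x`
(★ 2e-α `exists_norm_one_sub_le`, ★ 2b-i realisability), whose `ι` is `θ`.  Hence `S ⧸ H′_m ≃ (𝒪⧸𝔭^m) × N₁` and **`Nat.card (S ⧸ H′_m) = q^{2m}·(q+1)q^{2m} = (q+1)q^{4m}`**
(★ B-p10 `natCard_quotient_pow_prod_norm_fibre` at `r = 1`) — Flicker's «the cardinality of `H′ ∩ K ∕ H′ ∩ d_mKd_m⁻¹` is `(q+1)q^{4m}`» (p. 96), the regime-`m ≤ [N∕2]` count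
of Prop. 16 together with ★ B-p14 `fixedPoint_cond00_iff_of_two_mul_le`.

## References
* [Flicker1998UnitaryFL] Y. Z. Flicker, *Elementary proof of the fundamental lemma for a unitary group*, Canad. J. Math. 50 (1998), Prop. 4 p. 82, Prop. 16 p. 96.
* [Serre1979] J.-P. Serre, *Local Fields*, GTM 67 (1979), Ch. V §2 (norm-one residues).
-/

set_option autoImplicit false

noncomputable section

open scoped MatrixGroups WithZero Valued
open Matrix

namespace Literature.NumberTheory.Automorphic

namespace UnitaryGroup

open Literature.NumberTheory.Automorphic.HermitianLattice Literature.NumberTheory.LocalFields.UnramifiedQuadraticNorm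

variable {K : Type*} [Field K] [Valued K ℤᵐ⁰] {ϖ : K}
  (σ : K →+* K) {J : Matrix (Fin 3) (Fin 3) K} (hJ : J = (StdForm.antidiagonal 3).over K)

/-- `toQuotPow` is multiplicative on integers. [cite: Flicker1998UnitaryFL, Prop. 8 p. 84] -/
theorem toQuotPow_mul (m : ℕ) {y z : K} (hy : Valued.v y ≤ 1) (hz : Valued.v z ≤ 1) :
    toQuotPow m (y * z) = toQuotPow m y * toQuotPow m z := by
  have hyz : Valued.v (y * z) ≤ 1 := by rw [map_mul]; exact mul_le_one' hy hz
  rw [toQuotPow_of_le m hy, toQuotPow_of_le m hz, toQuotPow_of_le m hyz, ← map_mul]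
  rfl

omit [Valued K ℤᵐ⁰] in
/-- `toQuotPow m 1 = 1`. [cite: Flicker1998UnitaryFL, Prop. 8 p. 84] -/
theorem toQuotPow_one [Valued K ℤᵐ⁰] (m : ℕ) : toQuotPow m (1 : K) = 1 := by
  rw [toQuotPow_of_le m (by rw [map_one] : Valued.v (1 : K) ≤ 1), ← (Ideal.Quotient.mk (𝓂[K] ^ m)).map_one]
  rfl

include hJ in
/-- **`[Stab(w₀) : H′_m] = (q + 1)·q^{4m}`** (Flicker p. 96): `S ⧸ H′_m ≃ (𝒪⧸𝔭^m) × {x̄ ∈ 𝒪⧸𝔭^{2m+1} : x̄·σ̄x̄ = 1}` via `z ↦ (q∕s, ι(z))` (★ FILE 2d classification, ★ FILE 2e-α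
residue data, ★ FILE 2b-i realisability), counted by ★ B-p10 `natCard_quotient_pow_prod_norm_fibre`.  Tokens: `S`, `H′_m`, `d` as in ★ (F2′)
`natCard_fixedPoints_unitaryInt_eq_finsum_flickerDiag`; `σO = (σ.comp 𝒪[K].subtype).codRestrict 𝒪[K] hσO` as in ★ `UnitaryThreePHTowerPackage`.
[cite: Flicker1998UnitaryFL, Prop. 16 p. 96] [cite: Serre1979, Ch. V §2] -/
theorem natCard_stabilizer_quotient_conjInt_eq (hd : LocalConjDatum σ ϖ) (hσO : ∀ y : 𝒪[K], (σ.comp 𝒪[K].subtype) y ∈ 𝒪[K])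
    [IsDiscreteValuationRing 𝒪[K]] [Finite (IsLocalRing.ResidueField 𝒪[K])] [IsAdicComplete 𝓂[K] 𝒪[K]]
    {a₀ : 𝒪[K]} (ha₀ : IsUnit (((σ.comp 𝒪[K].subtype).codRestrict 𝒪[K] hσO) a₀ - a₀)) {q : ℕ} (hq : Nat.card (IsLocalRing.ResidueField 𝒪[K]) = q ^ 2)
    (d : ℕ → ↥(unitaryGroupOfForm σ J)) (m : ℕ)
    (hdm : ((d m : GL (Fin 3) K) : Matrix (Fin 3) (Fin 3) K) = !![ϖ ^ m, 0, 0; 0, 1, 0; 0, 0, (ϖ ^ m)⁻¹]) :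
    Nat.card (↥(MulAction.stabilizer (↥(unitaryGroupOfForm σ J)) (![1, 0, -(2 * ϖ)] : Fin 3 → K)) ⧸
        ((unitaryInt σ J).map (MulAut.conj (d m)).toMonoidHom).subgroupOf
          (MulAction.stabilizer (↥(unitaryGroupOfForm σ J)) (![1, 0, -(2 * ϖ)] : Fin 3 → K))) = (q + 1) * q ^ (4 * m) := by
  classical
  -- the restricted involution and its reduction mod `𝔭^{2m+1}`
  set σO : 𝒪[K] →+* 𝒪[K] := (σ.comp 𝒪[K].subtype).codRestrict 𝒪[K] hσO with hσOdef
  have hσOσ : ∀ a, σO (σO a) = a := fun a => Subtype.ext (hd.σσ a)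
  have hcomap := maximalIdeal_pow_le_comap_codRestrict σ hd.vϖ hd.vσ hσO (2 * m + 1)
  set σq := Ideal.quotientMap (𝓂[K] ^ (2 * m + 1)) σO hcomap with hσq
  let N : Subgroup ↥(MulAction.stabilizer (↥(unitaryGroupOfForm σ J)) (![1, 0, -(2 * ϖ)] : Fin 3 → K)) :=
    ((unitaryInt σ J).map (MulAut.conj (d m)).toMonoidHom).subgroupOf (MulAction.stabilizer (↥(unitaryGroupOfForm σ J)) (![1, 0, -(2 * ϖ)] : Fin 3 → K))
  let X := (𝒪[K] ⧸ 𝓂[K] ^ m) × {x : 𝒪[K] ⧸ 𝓂[K] ^ (2 * m + 1) // x * σq x = Ideal.Quotient.mk _ 1}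
  -- the target count (B-p10)
  have hX : Nat.card X = (q + 1) * q ^ (4 * m) := natCard_quotient_pow_prod_norm_fibre σO hσOσ ha₀ hq m isUnit_one (map_one σO)
  rw [← hX]
  -- basic facts
  have h4 : Valued.v (4 : K) = 1 := by rw [show (4 : K) = 2 * 2 by norm_num, map_mul, hd.v2, one_mul]
  have hϖ1 : Valued.v ϖ < 1 := by rw [hd.vϖ, ← WithZero.exp_zero]; exact WithZero.exp_lt_exp.2 (by norm_num)
  have hϖm1 : Valued.v (ϖ ^ (2 * m + 1)) < 1 := by rw [map_pow]; exact pow_lt_one₀ zero_le hϖ1 (by omega)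
  -- coordinates of stabiliser elements (chosen once)
  have hcoords : ∀ z : ↥(MulAction.stabilizer (↥(unitaryGroupOfForm σ J)) (![1, 0, -(2 * ϖ)] : Fin 3 → K)), ∃ c : K × K × K × K, (((z : ↥(unitaryGroupOfForm σ J)) : GL (Fin 3) K) : Matrix (Fin 3) (Fin 3) K) =
      !![1 + 2 * ϖ * c.1, c.2.1, c.1; 2 * ϖ * c.2.2.1, c.2.2.2, c.2.2.1; 4 * ϖ ^ 2 * c.1, 2 * ϖ * c.2.1, 1 + 2 * ϖ * c.1] := fun z => by
    obtain ⟨b, q', r, s, h⟩ := exists_coords_of_mem_stabilizer σ hJ hd z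
    exact ⟨(b, q', r, s), h⟩
  choose cz hcz using hcoords
  -- representatives of residue classes mod `𝔭^m` and the canonical unit vectors over them
  have hrep : ∀ ū : 𝒪[K] ⧸ 𝓂[K] ^ m, ∃ u₀ : 𝒪[K], Ideal.Quotient.mk _ u₀ = ū := Ideal.Quotient.mk_surjective
  choose out hout using hrep
  have hbase : ∀ ū : 𝒪[K] ⧸ 𝓂[K] ^ m, ∃ s₀ : K, σ s₀ = s₀ ∧ Valued.v s₀ = 1 ∧
      σ s₀ * s₀ + 4 * ϖ * (σ ((out ū : K) * s₀) * ((out ū : K) * s₀)) = 1 := fun ū => exists_fixed_unit_vector σ hd (out ū).2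
  choose bs hbs using hbase
  -- the invariant functions
  let uof : ↥(MulAction.stabilizer (↥(unitaryGroupOfForm σ J)) (![1, 0, -(2 * ϖ)] : Fin 3 → K)) → K := fun z => (cz z).2.1 / (cz z).2.2.2
  let Dof : ↥(MulAction.stabilizer (↥(unitaryGroupOfForm σ J)) (![1, 0, -(2 * ϖ)] : Fin 3 → K)) → K := fun z => (1 + 4 * ϖ * (cz z).1) * (cz z).2.2.2 - 4 * ϖ * (cz z).2.1 * (cz z).2.2.1
  let ιof : ↥(MulAction.stabilizer (↥(unitaryGroupOfForm σ J)) (![1, 0, -(2 * ϖ)] : Fin 3 → K)) → K := fun z =>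
    Dof z * (σ (cz z).2.2.2 * bs (toQuotPow m (uof z)) + 4 * ϖ * (σ (cz z).2.1 * ((out (toQuotPow m (uof z)) : K) * bs (toQuotPow m (uof z)))))
  -- valuations
  have hbounds : ∀ z : ↥(MulAction.stabilizer (↥(unitaryGroupOfForm σ J)) (![1, 0, -(2 * ϖ)] : Fin 3 → K)), Valued.v (cz z).2.2.2 = 1 ∧ Valued.v (cz z).2.1 ≤ 1 := fun z => by
    obtain ⟨hs, hq', -, -⟩ := stabilizer_valuation_bounds σ hJ hd (hcz z); exact ⟨hs, hq'⟩
  have hU2 : ∀ z : ↥(MulAction.stabilizer (↥(unitaryGroupOfForm σ J)) (![1, 0, -(2 * ϖ)] : Fin 3 → K)), σ (cz z).2.2.2 * (cz z).2.2.2 + 4 * ϖ * (σ (cz z).2.1 * (cz z).2.1) = 1 := fun z =>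
    (stabilizer_unitarity_relations σ hJ hd (hcz z)).2.1
  have hu1 : ∀ z : ↥(MulAction.stabilizer (↥(unitaryGroupOfForm σ J)) (![1, 0, -(2 * ϖ)] : Fin 3 → K)), Valued.v (uof z) ≤ 1 := fun z => by
    show Valued.v ((cz z).2.1 / (cz z).2.2.2) ≤ 1
    rw [map_div₀, (hbounds z).1, div_one]; exact (hbounds z).2
  have hD1 : ∀ z : ↥(MulAction.stabilizer (↥(unitaryGroupOfForm σ J)) (![1, 0, -(2 * ϖ)] : Fin 3 → K)), σ (Dof z) * Dof z = 1 := fun z => map_det_mul_det_eq_one σ hJ hd (hcz z)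
  have hvD : ∀ z : ↥(MulAction.stabilizer (↥(unitaryGroupOfForm σ J)) (![1, 0, -(2 * ϖ)] : Fin 3 → K)), Valued.v (Dof z) ≤ 1 := fun z => by
    have h := congrArg (fun x : K => Valued.v x) (hD1 z)
    simp only [map_mul, hd.vσ, map_one] at h
    exact mul_self_le_one_iff.1 h.le
  -- the base vector of the class of `z` is `ϖ^m`-close to `v_z`
  have hclose₀ : ∀ z : ↥(MulAction.stabilizer (↥(unitaryGroupOfForm σ J)) (![1, 0, -(2 * ϖ)] : Fin 3 → K)), Valued.v ((cz z).2.2.2 * ((out (toQuotPow m (uof z)) : K) * bs (toQuotPow m (uof z))) -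
      (cz z).2.1 * bs (toQuotPow m (uof z))) ≤ Valued.v (ϖ ^ m) := fun z => by
    have hs0 : (cz z).2.2.2 ≠ 0 := fun h0 => by have := (hbounds z).1; rw [h0, map_zero] at this; exact zero_ne_one this
    have e : (cz z).2.2.2 * ((out (toQuotPow m (uof z)) : K) * bs (toQuotPow m (uof z))) - (cz z).2.1 * bs (toQuotPow m (uof z)) =
        (cz z).2.2.2 * bs (toQuotPow m (uof z)) * ((out (toQuotPow m (uof z)) : K) - uof z) := by
      show _ = (cz z).2.2.2 * bs (toQuotPow m (uof z)) * ((out (toQuotPow m (uof z)) : K) - (cz z).2.1 / (cz z).2.2.2)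
      field_simp
    rw [e, map_mul, map_mul, (hbounds z).1, (hbs _).2.1, one_mul, one_mul]
    -- `out ū ≡ u (mod 𝔭^m)`
    have hcls : toQuotPow m ((out (toQuotPow m (uof z)) : K)) = toQuotPow m (uof z) := by
      rw [toQuotPow_of_le m (out (toQuotPow m (uof z))).2]
      exact hout _
    exact (toQuotPow_eq_toQuotPow_iff hd.vϖ m (out (toQuotPow m (uof z))).2 (hu1 z)).1 hcls
  have hvι : ∀ z : ↥(MulAction.stabilizer (↥(unitaryGroupOfForm σ J)) (![1, 0, -(2 * ϖ)] : Fin 3 → K)), Valued.v (ιof z) ≤ 1 := fun z => by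
    show Valued.v (Dof z * _) ≤ 1
    rw [map_mul, (v_form_eq_one_of_unit σ hd (hU2 z) (hbs (toQuotPow m (uof z))).2.2).1, mul_one]
    exact hvD z
  -- `ι(z)` is a norm-one residue mod `𝔭^{2m+1}`
  have hιN : ∀ z : ↥(MulAction.stabilizer (↥(unitaryGroupOfForm σ J)) (![1, 0, -(2 * ϖ)] : Fin 3 → K)), toQuotPow (2 * m + 1) (ιof z) * σq (toQuotPow (2 * m + 1) (ιof z)) = Ideal.Quotient.mk _ 1 := fun z => by
    have hσι : Valued.v (σ (ιof z)) ≤ 1 := by rw [hd.vσ]; exact hvι z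
    have h1 : Valued.v (1 : K) ≤ 1 := by rw [map_one]
    rw [quotientMap_toQuotPow σ hd.vϖ hd.vσ hσO (2 * m + 1) (hvι z), ← toQuotPow_mul (2 * m + 1) (hvι z) hσι, map_one,
      ← toQuotPow_one (2 * m + 1), toQuotPow_eq_toQuotPow_iff hd.vϖ (2 * m + 1) (by rw [map_mul]; exact mul_le_one' (hvι z) hσι) h1]
    have h := v_norm_invariant_sub_one_le σ hd m (hD1 z) (hU2 z) (hbs (toQuotPow m (uof z))).2.2 (hclose₀ z)
    rwa [mul_comm (σ _)] at h
  -- the classifying map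
  let ρX : ↥(MulAction.stabilizer (↥(unitaryGroupOfForm σ J)) (![1, 0, -(2 * ϖ)] : Fin 3 → K)) → X := fun z => (toQuotPow m (uof z), ⟨toQuotPow (2 * m + 1) (ιof z), hιN z⟩)
  -- the key: `ρX z = ρX z′ ↔ z⁻¹ z′ ∈ N`
  have hkey : ∀ z z' : ↥(MulAction.stabilizer (↥(unitaryGroupOfForm σ J)) (![1, 0, -(2 * ϖ)] : Fin 3 → K)), ρX z = ρX z' ↔ (QuotientGroup.mk z : ↥(MulAction.stabilizer (↥(unitaryGroupOfForm σ J)) (![1, 0, -(2 * ϖ)] : Fin 3 → K)) ⧸ N) = QuotientGroup.mk z' := by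
    intro z z'
    have hcrit := mk_eq_mk_iff_invariant σ hJ hd d m hdm (hcz z) (hcz z') (hbs (toQuotPow m (uof z))).2.2 (hclose₀ z)
    rw [hcrit]
    constructor
    · intro h
      have h1 : toQuotPow m (uof z) = toQuotPow m (uof z') := congrArg Prod.fst h
      have h2 : toQuotPow (2 * m + 1) (ιof z) = toQuotPow (2 * m + 1) (ιof z') := congrArg Subtype.val (congrArg Prod.snd h)
      have hc1 : Valued.v ((cz z).2.2.2 * (cz z').2.1 - (cz z).2.1 * (cz z').2.2.2) ≤ Valued.v (ϖ ^ m) := by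
        rw [← v_div_sub_div_eq (hbounds z).1 (hbounds z').1]
        exact (toQuotPow_eq_toQuotPow_iff hd.vϖ m (hu1 z) (hu1 z')).1 h1
      refine ⟨hc1, ?_⟩
      -- same class ⇒ same base vector, and `ι ≡ ι′`
      have hι := (toQuotPow_eq_toQuotPow_iff hd.vϖ (2 * m + 1) (hvι z') (hvι z)).1 h2.symm
      simp only [ιof, Dof] at hι
      rw [← h1] at hι
      exact hι
    · rintro ⟨hc1, hc2⟩
      have h1 : toQuotPow m (uof z) = toQuotPow m (uof z') := by
        rw [toQuotPow_eq_toQuotPow_iff hd.vϖ m (hu1 z) (hu1 z'), v_div_sub_div_eq (hbounds z).1 (hbounds z').1]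
        exact hc1
      have h2 : toQuotPow (2 * m + 1) (ιof z) = toQuotPow (2 * m + 1) (ιof z') := by
        rw [toQuotPow_eq_toQuotPow_iff hd.vϖ (2 * m + 1) (hvι z) (hvι z'), ← Valuation.map_neg, neg_sub]
        simp only [ιof, Dof]
        rw [← h1]
        exact hc2
      exact Prod.ext (by exact h1) (Subtype.ext (by exact h2))
  -- descend to the quotient
  have hwd : ∀ a b : ↥(MulAction.stabilizer (↥(unitaryGroupOfForm σ J)) (![1, 0, -(2 * ϖ)] : Fin 3 → K)), QuotientGroup.leftRel N a b → ρX a = ρX b := fun a b hab =>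
    (hkey a b).2 (Quotient.sound hab)
  let ρQ : ↥(MulAction.stabilizer (↥(unitaryGroupOfForm σ J)) (![1, 0, -(2 * ϖ)] : Fin 3 → K)) ⧸ N → X := Quotient.lift ρX hwd
  have hbij : Function.Bijective ρQ := by
    constructor
    · intro q₁ q₂ h
      induction q₁ using QuotientGroup.induction_on with | H a => ?_
      induction q₂ using QuotientGroup.induction_on with | H b => ?_
      exact (hkey a b).1 h
    · rintro ⟨ū, ⟨xq, hx⟩⟩
      obtain ⟨x₁, rfl⟩ := Ideal.Quotient.mk_surjective xq
      -- the norm of `x₁` is `≡ 1 (mod 𝔭^{2m+1})`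
      have hx1 : Valued.v (σ (x₁ : K) * x₁ - 1) ≤ Valued.v (ϖ ^ (2 * m + 1)) := by
        have hx' : toQuotPow (2 * m + 1) ((x₁ : K) * σ x₁) = toQuotPow (2 * m + 1) 1 := by
          have hσx : Valued.v (σ (x₁ : K)) ≤ 1 := by rw [hd.vσ]; exact x₁.2
          rw [toQuotPow_mul (2 * m + 1) x₁.2 hσx, toQuotPow_one, ← quotientMap_toQuotPow σ hd.vϖ hd.vσ hσO (2 * m + 1) x₁.2,
            toQuotPow_of_le (2 * m + 1) x₁.2]
          rw [map_one] at hx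
          exact hx
        have h := (toQuotPow_eq_toQuotPow_iff hd.vϖ (2 * m + 1)
          (by rw [map_mul, hd.vσ]; exact mul_le_one' x₁.2 x₁.2) (by rw [map_one])).1 hx'
        rwa [mul_comm] at h
      obtain ⟨θ, hθ, hθx⟩ := exists_norm_one_sub_le σ hd (hx1.trans_lt hϖm1)
      have hθx' : Valued.v (θ - x₁) ≤ Valued.v (ϖ ^ (2 * m + 1)) :=
        hθx.trans ((mul_le_mul' x₁.2 hx1).trans_eq (one_mul _))
      -- the stabiliser element with coordinates `(A, q, s) = (θ s₀, u₀ s₀, s₀)`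
      obtain ⟨hσs₀, hvs₀, hunit₀⟩ := hbs ū
      have hR2 : σ (θ * bs ū) * (θ * bs ū) = σ (bs ū) * bs ū := by
        rw [map_mul]; linear_combination (σ (bs ū) * bs ū) * hθ
      obtain ⟨h, hmem, hcoe⟩ := exists_mem_stabilizer_coe_eq_of_norm_relations σ hJ hd hunit₀ hR2
      refine ⟨QuotientGroup.mk ⟨h, hmem⟩, ?_⟩
      -- identify the chosen coordinates of `⟨h, hmem⟩`
      have hc := hcz ⟨h, hmem⟩
      rw [show (((⟨h, hmem⟩ : ↥(MulAction.stabilizer (↥(unitaryGroupOfForm σ J)) (![1, 0, -(2 * ϖ)] : Fin 3 → K))) : ↥(unitaryGroupOfForm σ J)) : GL (Fin 3) K) = (h : GL (Fin 3) K) from rfl, hcoe] at hc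
      have eq01 := congrFun (congrFun hc 0) 1
      have eq11 := congrFun (congrFun hc 1) 1
      have eq02 := congrFun (congrFun hc 0) 2
      have eq12 := congrFun (congrFun hc 1) 2
      simp only [Matrix.of_apply, Matrix.cons_val', Matrix.cons_val_zero, Matrix.cons_val_one, Matrix.cons_val_fin_one,
        Matrix.cons_val_two, Matrix.tail_cons, Matrix.head_cons, Matrix.empty_val'] at eq01 eq11 eq02 eq12
      -- `u(z) = u₀`, hence the class and the base vector are those of `ū`
      have hs0 : bs ū ≠ 0 := fun h0 => by rw [h0, map_zero] at hvs₀; exact zero_ne_one hvs₀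
      have hu : uof ⟨h, hmem⟩ = (out ū : K) := by
        show (cz ⟨h, hmem⟩).2.1 / (cz ⟨h, hmem⟩).2.2.2 = _
        rw [← eq01, ← eq11, mul_div_cancel_right₀ _ hs0]
      have hclass : toQuotPow m (uof ⟨h, hmem⟩) = ū := by rw [hu, toQuotPow_of_le m (out ū).2]; exact hout ū
      -- `ι(z) = D_z = θ`
      have hD : Dof ⟨h, hmem⟩ = θ := by
        show (1 + 4 * ϖ * (cz ⟨h, hmem⟩).1) * (cz ⟨h, hmem⟩).2.2.2 - 4 * ϖ * (cz ⟨h, hmem⟩).2.1 * (cz ⟨h, hmem⟩).2.2.1 = θ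
        have hdet := det_stabilizerModel_eq σ hJ hd (hcz ⟨h, hmem⟩)
        rw [Matrix.det_fin_two_of] at hdet
        rw [show (1 + 4 * ϖ * (cz ⟨h, hmem⟩).1) * (cz ⟨h, hmem⟩).2.2.2 - 4 * ϖ * (cz ⟨h, hmem⟩).2.1 * (cz ⟨h, hmem⟩).2.2.1 =
          (1 + 4 * ϖ * (cz ⟨h, hmem⟩).1) * (cz ⟨h, hmem⟩).2.2.2 - (cz ⟨h, hmem⟩).2.1 * (4 * ϖ * (cz ⟨h, hmem⟩).2.2.1) by ring, hdet,
          ← eq11, hσs₀, ← eq02]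
        have hϖ0 : ϖ ≠ 0 := hd.ϖ_ne_zero
        have h20 : (2 : K) ≠ 0 := fun h0 => by have := hd.v2; rw [h0, map_zero] at this; exact zero_ne_one this
        have h40 : (4 : K) ≠ 0 := by rw [show (4 : K) = 2 * 2 by norm_num]; exact mul_ne_zero h20 h20
        field_simp
        ring
      have hι : ιof ⟨h, hmem⟩ = θ := by
        show Dof ⟨h, hmem⟩ * _ = θ
        rw [hD, hclass, ← eq11, ← eq01]
        have hΦ : σ (bs ū) * bs ū + 4 * ϖ * (σ ((out ū : K) * bs ū) * ((out ū : K) * bs ū)) = 1 := hunit₀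
        rw [hΦ, mul_one]
      apply Prod.ext
      · exact hclass
      · apply Subtype.ext
        show toQuotPow (2 * m + 1) (ιof ⟨h, hmem⟩) = Ideal.Quotient.mk _ x₁
        rw [hι, ← toQuotPow_of_le (2 * m + 1) x₁.2, toQuotPow_eq_toQuotPow_iff hd.vϖ (2 * m + 1) _ x₁.2]
        · exact hθx'
        · -- `|θ| ≤ 1`
          have h := congrArg (fun x : K => Valued.v x) hθ
          simp only [map_mul, hd.vσ, map_one] at h
          exact mul_self_le_one_iff.1 h.le
  exact Nat.card_congr (Equiv.ofBijective ρQ hbij)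

end UnitaryGroup

end Literature.NumberTheory.Automorphic

end
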